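import Literature.Analysis.FluidPDE.ScalarFourierSynthesis
import HarnessLib

/-!
# Fourier-side data: coefficients of smooth space–time fields on `T^d`, products and the Laplacian

Analysis/FluidPDE proof file, fourth of the files discharging
`Literature.Analysis.FluidPDE.Torus.exists_unique_isClassicalScalarTransportForcedOn`. It turns
the smooth data of the advection–diffusion equation (drift components, source, datum; as
`ℂ`-valued functions) into the hypotheses of the Fourier-side Picard iteration
(`ScalarFourierPicard`) and provides the dictionary used to verify the equation
coefficientwise (`PassiveScalarWellPosednessProofs`):

* `mFourierCoeff_laplacian` — `𝓕(Δg)(k) = -4π²|k|² ĝ(k)` for smooth `ℂ`-valued `g`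
  (Grafakos 2014, Prop. 3.2.6 (8) twice; the tree's `Torus.mFourierCoeff_partialDeriv`), the
  elliptic iterates `(1 - Δ/4π²)^p` and the resulting **polynomial decay of every order of the
  coefficients of a smooth function** (`exists_hasDecay_mFourierCoeff`; Grafakos 2014, §3.3.1),
  converted to the sup-norm weights `(1 + ‖k‖)^{-K}` of `FourierNS.HasDecay`
  (`hasDecay_of_freqNormSq_bound`);
* `mFourierCoeff_mul` — **products become lattice convolutions**,
  `𝓕(fg)(k) = ∑ₘ f̂(m) ĝ(k-m)` for continuous `f` with absolutely summable coefficients and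
  continuous `g` (Fourier inversion for `f`, exchange of sum and integral);
* `hasDerivWithinAt_mFourierCoeff` — `d/dt 𝓕(ψ(t))(k) = 𝓕(∂ₜψ(t))(k)` within the time set
  (differentiation under the torus integral, tree
  `Torus.IsSmoothSpaceTimeOn.hasDerivWithinAt_integral`), uniform decay on compact time
  intervals (`exists_hasDecay_mFourierCoeff_spaceTime`), and the conclusion
  `isCoeffFamily_coeffFamily`: **the coefficients of `∂ₜⁱψ` of a jointly smooth `ψ` on
  `[0,T] × T^d` form a coefficient family of every order**.

## Mathlib search

`integral_tsum_of_summable_integral_norm`, `UnitAddTorus.mFourier_add`, `derivWithin` API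
(`HasDerivWithinAt.const_smul`, `.derivWithin`), `IsCompact.exists_bound_of_continuousOn`.
Tree: `TorusFourierCalculus` (`mFourierCoeff_partialDeriv`), `TorusFourierSeries`
(vector-valued decay lemmas, of which the `ℂ`-valued ones here are twins), `TorusSpaceTime`,
`TorusCalculusProofs`, `TorusTrigPoly` (`mFourierCoeff_sub`), `TorusFourierModes`
(`mFourierCoeff_finset_sum`).

## References

* L. Grafakos, *Classical Fourier Analysis*, 3rd ed., GTM 249 (2014), Prop. 3.2.6 (8),
  §3.3.1. [Grafakos2014]
* N. V. Krylov, *Lectures on Elliptic and Parabolic Equations in Hölder Spaces*, AMS 1996,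
  Thm. 9.2.3. [Krylov1996]
-/

noncomputable section

namespace Literature.Analysis.FluidPDE

namespace ScalarFourier

open MeasureTheory Real Set Filter UnitAddTorus Complex
open scoped Topology ContDiff
open FourierNS (HasDecay)
open Literature.Analysis.FunctionSpaces.Torus (proj stLift timeDerivWithin IsSmoothSpaceTimeOn IsSmooth
  laplacian partialDeriv freqNormSq)

variable {d : Type*} [Fintype d] [DecidableEq d]

/-! ### Fourier coefficients of the Laplacian and of the elliptic iterates (`ℂ`-valued) -/

section Laplacian

/-- **Fourier coefficients of the Laplacian** of a smooth `ℂ`-valued function on `T^d`: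
`𝓕(Δg)(k) = -4π²|k|² ĝ(k)` (Grafakos 2014, Prop. 3.2.6 (8) twice; the `ℂ`-valued twin of
`Torus.mFourierCoeff_complexify_laplacian`). [folklore] -/
theorem mFourierCoeff_laplacian {g : UnitAddTorus d → ℂ} (hg : IsSmooth g) (k : d → ℤ) :
    mFourierCoeff (laplacian g) k = -((4 * π ^ 2 * freqNormSq k : ℝ) : ℂ) * mFourierCoeff g k := by
  have hfun : laplacian g = fun x => ∑ i, partialDeriv i (partialDeriv i g) x :=
    funext (FunctionSpaces.Torus.laplacian_eq_sum_partialDeriv_partialDeriv hg)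
  rw [hfun, FunctionSpaces.Torus.mFourierCoeff_finset_sum _ fun i _ =>
    ((hg.partialDeriv i).partialDeriv i).continuous.integrable_unitAddTorus]
  simp_rw [FunctionSpaces.Torus.mFourierCoeff_partialDeriv (hg.partialDeriv _),
    FunctionSpaces.Torus.mFourierCoeff_partialDeriv hg, smul_smul, ← Finset.sum_smul, smul_eq_mul]
  congr 1
  rw [FunctionSpaces.Torus.freqNormSq]
  push_cast
  rw [Finset.mul_sum, ← Finset.sum_neg_distrib]
  refine Finset.sum_congr rfl fun i _ => ?_
  linear_combination ((2 : ℂ) * π * (k i : ℂ)) ^ 2 * Complex.I_mul_I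

omit [DecidableEq d] in
/-- Fourier coefficients of `b - c • b'` for integrable `ℂ`-valued `b`, `b'`, `c ∈ ℝ`. [folklore] -/
theorem mFourierCoeff_sub_const_smul {b b' : UnitAddTorus d → ℂ} (hb : Integrable b volume)
    (hb' : Integrable b' volume) (c : ℝ) (k : d → ℤ) :
    mFourierCoeff (fun x => b x - c • b' x) k = mFourierCoeff b k - (c : ℂ) * mFourierCoeff b' k := by
  have hφ : MemLp (fun x : UnitAddTorus d => mFourier (-k) x) (⊤ : ENNReal) volume :=
    memLp_top_of_bound (mFourier (-k)).continuous.aestronglyMeasurable 1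
      (Eventually.of_forall fun x => ((mFourier (-k)).norm_coe_le_norm x).trans_eq mFourier_norm)
  have hi : Integrable (fun x => mFourier (-k) x • b x) volume := hb.smul_of_top_right hφ
  have hi' : Integrable (fun x => mFourier (-k) x • b' x) volume := hb'.smul_of_top_right hφ
  rw [FunctionSpaces.Torus.mFourierCoeff_eq_integral_volume,
    FunctionSpaces.Torus.mFourierCoeff_eq_integral_volume,
    FunctionSpaces.Torus.mFourierCoeff_eq_integral_volume, ← integral_const_mul,
    ← integral_sub hi (hi'.const_mul _)]
  refine integral_congr_ae (ae_of_all _ fun x => ?_)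
  simp only [smul_eq_mul, Complex.real_smul]
  ring

omit [DecidableEq d] in
/-- The elliptic operator `b ↦ b - (4π²)⁻¹ Δb` preserves smoothness of `ℂ`-valued functions,
and so do its iterates. [folklore] -/
theorem isSmooth_iterate_oneSubLaplacian {g : UnitAddTorus d → ℂ} (hg : IsSmooth g) (p : ℕ) :
    IsSmooth ((fun b : UnitAddTorus d → ℂ => fun x => b x - (4 * π ^ 2)⁻¹ • laplacian b x)^[p] g) := by
  induction p generalizing g with
  | zero => exact hg
  | succ p ih =>
    rw [Function.iterate_succ_apply]
    exact ih (hg.sub (hg.laplacian.smul _))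

/-- **Fourier multiplier of the iterated elliptic operator** (`ℂ`-valued):
`𝓕((1 - (4π²)⁻¹Δ)^p g)(k) = (1 + |k|²)^p ĝ(k)`. [folklore] -/
theorem mFourierCoeff_iterate_oneSubLaplacian {g : UnitAddTorus d → ℂ} (hg : IsSmooth g) (p : ℕ)
    (k : d → ℤ) :
    mFourierCoeff ((fun b : UnitAddTorus d → ℂ => fun x => b x - (4 * π ^ 2)⁻¹ • laplacian b x)^[p] g) k
      = (((1 + freqNormSq k) ^ p : ℝ) : ℂ) * mFourierCoeff g k := by
  induction p generalizing g with
  | zero => simp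
  | succ p ih =>
    have hstep : IsSmooth (fun x => g x - (4 * π ^ 2)⁻¹ • laplacian g x) :=
      hg.sub (hg.laplacian.smul _)
    rw [Function.iterate_succ_apply, ih hstep,
      mFourierCoeff_sub_const_smul hg.continuous.integrable_unitAddTorus
        hg.laplacian.continuous.integrable_unitAddTorus, mFourierCoeff_laplacian hg]
    have hπ : (π : ℂ) ≠ 0 := by exact_mod_cast Real.pi_ne_zero
    push_cast
    field_simp
    ring

/-- **Decay from an elliptic iterate bound**: if `‖((1 - (4π²)⁻¹Δ)^p g)(x)‖ ≤ M` for all `x`,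
then `‖ĝ(k)‖ ≤ M (1 + |k|²)^{-p}`. [folklore] -/
theorem norm_mFourierCoeff_le_of_iterate_bound {g : UnitAddTorus d → ℂ} (hg : IsSmooth g)
    {p : ℕ} {M : ℝ}
    (hM : ∀ x, ‖((fun b : UnitAddTorus d → ℂ => fun x => b x - (4 * π ^ 2)⁻¹ • laplacian b x)^[p] g) x‖ ≤ M)
    (k : d → ℤ) : ‖mFourierCoeff g k‖ ≤ M * ((1 + freqNormSq k) ^ p)⁻¹ := by
  have hpos : 0 < (1 + freqNormSq k) ^ p := pow_pos (by linarith [FunctionSpaces.Torus.freqNormSq_nonneg k]) p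
  have h := FunctionSpaces.Torus.norm_mFourierCoeff_le_of_forall_norm_le hM k
  rw [mFourierCoeff_iterate_oneSubLaplacian hg p k, norm_mul, Complex.norm_real, Real.norm_eq_abs,
    abs_of_pos hpos] at h
  rw [← div_eq_mul_inv, le_div_iff₀ hpos, mul_comm]
  exact h

/-- `(1 + ‖k‖)² ≤ 2 (1 + |k|²)` (sup norm against Euclidean length). [folklore] -/
theorem one_add_norm_sq_le (k : d → ℤ) : (1 + ‖k‖) ^ 2 ≤ 2 * (1 + freqNormSq k) := by
  have h1 : ‖k‖ ^ 2 ≤ freqNormSq k := by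
    rw [freqNormSq_eq_norm_latticeVec_sq]
    exact pow_le_pow_left₀ (norm_nonneg _) (norm_le_norm_latticeVec k) 2
  nlinarith [norm_nonneg k, sq_nonneg (‖k‖ - 1), h1]

/-- **From `|k|²`-weights to sup-norm weights**: a bound `‖c(k)‖ ≤ M (1 + |k|²)^{-p}` gives
decay of order `2p` in the sup norm, `HasDecay (2p) (2^p M) c`. [folklore] -/
theorem hasDecay_of_freqNormSq_bound {c : (d → ℤ) → ℂ} {M : ℝ} {p : ℕ} (hM : 0 ≤ M)
    (h : ∀ k, ‖c k‖ ≤ M * ((1 + freqNormSq k) ^ p)⁻¹) : HasDecay (2 * p) (2 ^ p * M) c := by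
  intro k
  have hpos : 0 < (1 + freqNormSq k) ^ p :=
    pow_pos (by linarith [FunctionSpaces.Torus.freqNormSq_nonneg k]) p
  have hpos' : 0 < (1 + ‖k‖) ^ (2 * p) := by positivity
  have hle : (1 + ‖k‖) ^ (2 * p) ≤ 2 ^ p * (1 + freqNormSq k) ^ p := by
    rw [pow_mul, ← mul_pow]
    exact pow_le_pow_left₀ (by positivity) (one_add_norm_sq_le k) p
  calc ‖c k‖ ≤ M * ((1 + freqNormSq k) ^ p)⁻¹ := h k
    _ ≤ M * (2 ^ p * ((1 + ‖k‖) ^ (2 * p))⁻¹) := by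
        refine mul_le_mul_of_nonneg_left ?_ hM
        rw [← div_eq_mul_inv, le_div_iff₀ hpos', inv_mul_eq_div, div_le_iff₀ hpos]
        exact hle
    _ = 2 ^ p * M * ((1 + ‖k‖) ^ (2 * p))⁻¹ := by ring

/-- **Every polynomial decay of the Fourier coefficients of a smooth function** on `T^d`
(Grafakos 2014, §3.3.1). [folklore] -/
theorem exists_hasDecay_mFourierCoeff {g : UnitAddTorus d → ℂ} (hg : IsSmooth g) (K : ℕ) :
    ∃ C : ℝ, 0 ≤ C ∧ HasDecay K C (fun k => mFourierCoeff g k) := by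
  obtain ⟨M, hM⟩ := isCompact_univ.exists_bound_of_continuousOn
    (isSmooth_iterate_oneSubLaplacian hg K).continuous.continuousOn
  have hM' : ∀ x, ‖((fun b : UnitAddTorus d → ℂ => fun x => b x - (4 * π ^ 2)⁻¹ • laplacian b x)^[K] g) x‖
      ≤ max M 0 := fun x => (hM x (mem_univ x)).trans (le_max_left _ _)
  refine ⟨2 ^ K * max M 0, by positivity, ?_⟩
  exact (hasDecay_of_freqNormSq_bound (le_max_right _ _)
    (norm_mFourierCoeff_le_of_iterate_bound hg hM')).of_le (by omega)

/-- The Fourier coefficients of a smooth function are absolutely summable. [folklore] -/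
theorem summable_norm_mFourierCoeff {g : UnitAddTorus d → ℂ} (hg : IsSmooth g) :
    Summable fun k => ‖mFourierCoeff g k‖ := by
  obtain ⟨C, -, hC⟩ := exists_hasDecay_mFourierCoeff hg (latOrder d)
  exact summable_norm_of_hasDecay le_rfl hC

end Laplacian

/-! ### Products ↦ lattice convolutions -/

section Product

omit [DecidableEq d]

/-- **The Fourier coefficients of a product are the lattice convolution of the coefficients**:
`𝓕(f g)(k) = ∑ₘ f̂(m) ĝ(k - m)` for continuous `f` with absolutely summable coefficients and
continuous `g` (expand `f` in its Fourier series, exchange sum and integral;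
Grafakos 2014, §3.1 / Prop. 3.1.2-type identity). [folklore] -/
theorem mFourierCoeff_mul {f g : UnitAddTorus d → ℂ} (hf : Continuous f)
    (hfs : Summable fun k => ‖mFourierCoeff f k‖) (hg : Continuous g) (k : d → ℤ) :
    mFourierCoeff (fun x => f x * g x) k =
      lconv (fun m => mFourierCoeff f m) (fun m => mFourierCoeff g m) k := by
  rw [lconv_apply, FunctionSpaces.Torus.mFourierCoeff_eq_integral_volume]
  obtain ⟨G, hG⟩ := isCompact_univ.exists_bound_of_continuousOn hg.continuousOn
  -- the terms of the expanded integrand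
  set F : (d → ℤ) → UnitAddTorus d → ℂ := fun m x =>
    mFourierCoeff f m * (mFourier (-k) x * mFourier m x * g x) with hF
  have hFint : ∀ m, Integrable (F m) volume := fun m =>
    (continuous_const.mul ((((mFourier (-k)).continuous.mul (mFourier m).continuous)).mul hg)).integrable_unitAddTorus
  have hFnorm : ∀ m x, ‖F m x‖ = ‖mFourierCoeff f m‖ * ‖g x‖ := fun m x => by
    simp only [hF, norm_mul, FunctionSpaces.Torus.norm_mFourier_apply, one_mul]
  have hsum : Summable fun m => ∫ x, ‖F m x‖ := by
    simp_rw [hFnorm, integral_const_mul]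
    exact hfs.mul_right _
  have hexch := integral_tsum_of_summable_integral_norm hFint hsum
  -- pointwise expansion of the integrand
  have hpt : ∀ x, mFourier (-k) x • (f x * g x) = ∑' m, F m x := fun x => by
    rw [← tsum_mFourierCoeff_mul_mFourier hf hfs x, smul_eq_mul, ← tsum_mul_right, ← tsum_mul_left]
    refine tsum_congr fun m => ?_
    simp only [hF]
    ring
  simp_rw [hpt]
  rw [← hexch]
  refine tsum_congr fun m => ?_
  have : F m = fun x => mFourierCoeff f m * (mFourier (-(k - m)) x • g x) := by
    funext x
    simp only [hF, smul_eq_mul, ← mFourier_add]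
    congr 3
    abel
  rw [this, integral_const_mul, ← FunctionSpaces.Torus.mFourierCoeff_eq_integral_volume]

end Product

/-! ### Coefficient families of jointly smooth space–time fields -/

section SpaceTime

variable {S : Set ℝ} {ψ : ℝ → UnitAddTorus d → ℂ}

/-- Slice-wise elliptic iterates of a jointly smooth field are jointly smooth. [folklore] -/
theorem isSmoothSpaceTimeOn_iterate_oneSubLaplacian (hψ : IsSmoothSpaceTimeOn S ψ)
    (hS : UniqueDiffOn ℝ S) (p : ℕ) :
    IsSmoothSpaceTimeOn S (fun t =>
      (fun b : UnitAddTorus d → ℂ => fun x => b x - (4 * π ^ 2)⁻¹ • laplacian b x)^[p] (ψ t)) := by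
  induction p generalizing ψ with
  | zero => exact hψ
  | succ p ih =>
    have h1 : IsSmoothSpaceTimeOn S (fun t x => ψ t x - (4 * π ^ 2)⁻¹ • laplacian (ψ t) x) :=
      hψ.sub ((hψ.laplacian hS).const_smul _)
    have h2 := ih h1
    simpa only [Function.iterate_succ_apply] using h2

/-- **Uniform polynomial decay of the coefficients of a jointly smooth field** on a compact
time interval: for every `K` there is `C` with `‖𝓕(ψ(t))(k)‖ ≤ C (1 + ‖k‖)^{-K}` for all
`t ∈ [0, T]`. [folklore] -/
theorem exists_hasDecay_mFourierCoeff_spaceTime {T : ℝ} (hT : 0 < T)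
    (hψ : IsSmoothSpaceTimeOn (Icc 0 T) ψ) (K : ℕ) :
    ∃ C : ℝ, 0 ≤ C ∧ ∀ t ∈ Icc 0 T, HasDecay K C (fun k => mFourierCoeff (ψ t) k) := by
  have hit := isSmoothSpaceTimeOn_iterate_oneSubLaplacian hψ (uniqueDiffOn_Icc hT) K
  obtain ⟨M, hM⟩ := hit.exists_norm_le_of_isCompact isCompact_Icc subset_rfl
  refine ⟨2 ^ K * max M 0, by positivity, fun t ht => ?_⟩
  have hM' : ∀ x, ‖((fun b : UnitAddTorus d → ℂ => fun x => b x - (4 * π ^ 2)⁻¹ • laplacian b x)^[K]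
      (ψ t)) x‖ ≤ max M 0 := fun x => (hM t ht x).trans (le_max_left _ _)
  exact (hasDecay_of_freqNormSq_bound (le_max_right _ _)
    (norm_mFourierCoeff_le_of_iterate_bound (hψ.isSmooth_slice ht) hM')).of_le (by omega)

omit [DecidableEq d] in
/-- A character times a jointly smooth field is jointly smooth. [folklore] -/
theorem isSmoothSpaceTimeOn_mFourier_smul (hψ : IsSmoothSpaceTimeOn S ψ) (k : d → ℤ) :
    IsSmoothSpaceTimeOn S (fun t x => mFourier k x • ψ t x) := by
  have h1 : ContDiffOn ℝ ∞ (fun z : ℝ × EuclideanSpace ℝ d => (mFourier k (proj z.2) : ℂ))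
      (S ×ˢ univ) :=
    ((FunctionSpaces.Torus.isSmooth_mFourier k).comp contDiff_snd).contDiffOn
  exact h1.smul hψ

omit [DecidableEq d] in
/-- **The time derivative of the slice coefficients within the time set**:
`d/dt 𝓕(ψ(t))(k) = 𝓕(∂ₜψ(t))(k)` within a convex `S` of unique differentiability
(differentiation under the torus integral, tree `Torus.IsSmoothSpaceTimeOn.hasDerivWithinAt_integral`). [folklore] -/
theorem hasDerivWithinAt_mFourierCoeff (hψ : IsSmoothSpaceTimeOn S ψ) (hS : Convex ℝ S)
    (hS' : UniqueDiffOn ℝ S) {t : ℝ} (ht : t ∈ S) (k : d → ℤ) :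
    HasDerivWithinAt (fun s => mFourierCoeff (ψ s) k) (mFourierCoeff (timeDerivWithin S ψ t) k) S t := by
  have hφ := isSmoothSpaceTimeOn_mFourier_smul hψ (-k)
  have h := hφ.hasDerivWithinAt_integral hS ht
  have hder : ∀ x, timeDerivWithin S (fun t x => mFourier (-k) x • ψ t x) t x =
      mFourier (-k) x • timeDerivWithin S ψ t x := fun x =>
    ((hψ.hasDerivWithinAt_slice ht x).const_smul (mFourier (-k) x)).derivWithin (hS' t ht)
  simp_rw [hder] at h
  simpa only [FunctionSpaces.Torus.mFourierCoeff_eq_integral_volume] using h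

omit [DecidableEq d] in
/-- Iterated one-sided time derivatives of a jointly smooth field are jointly smooth. [folklore] -/
theorem isSmoothSpaceTimeOn_iterate_timeDerivWithin (hψ : IsSmoothSpaceTimeOn S ψ)
    (hS : UniqueDiffOn ℝ S) (i : ℕ) : IsSmoothSpaceTimeOn S ((timeDerivWithin S)^[i] ψ) := by
  induction i with
  | zero => exact hψ
  | succ i ih =>
    rw [Function.iterate_succ_apply']
    exact ih.timeDerivWithin hS

/-- **The coefficient family of a jointly smooth field is a coefficient family of every
order** on `[0, T]`: decay of every order uniformly in time, continuity, and
`∂ₜ 𝓕(∂ₜⁱψ(t)) = 𝓕(∂ₜⁱ⁺¹ψ(t))` within `[0, T]`. [folklore] -/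
theorem isCoeffFamily_coeffFamily {T : ℝ} (hT : 0 < T) (hψ : IsSmoothSpaceTimeOn (Icc 0 T) ψ)
    (n : ℕ) : IsCoeffFamily T n (coeffFamily (Icc 0 T) ψ) := by
  have hS : UniqueDiffOn ℝ (Icc 0 T) := uniqueDiffOn_Icc hT
  have hsm : ∀ i, IsSmoothSpaceTimeOn (Icc 0 T) ((timeDerivWithin (Icc 0 T))^[i] ψ) :=
    isSmoothSpaceTimeOn_iterate_timeDerivWithin hψ hS
  have hder : ∀ i m, ∀ t ∈ Icc 0 T, HasDerivWithinAt (fun s => coeffFamily (Icc 0 T) ψ i s m)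
      (coeffFamily (Icc 0 T) ψ (i + 1) t m) (Icc 0 T) t := by
    intro i m t ht
    have h := hasDerivWithinAt_mFourierCoeff (hsm i) (convex_Icc 0 T) hS ht m
    simpa only [coeffFamily, Function.iterate_succ_apply'] using h
  refine ⟨fun i _ K => ?_, fun i _ m t ht => (hder i m t ht).continuousWithinAt, fun i _ m t ht => hder i m t ht⟩
  obtain ⟨C, -, hC⟩ := exists_hasDecay_mFourierCoeff_spaceTime hT (hsm i) K
  exact ⟨C, hC⟩

end SpaceTime

end ScalarFourier

end Literature.Analysis.FluidPDE

end
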